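import Summits.ABC.IUTFork.Cor312SettingReal
import HarnessLib

/-!
# [IUTchIII] Corollary 3.12, statement — lattice stability of (Ind1), (Ind2) bounds the possible images

Record-only file (D-0012) of the abc-iut cell (Cor. 3.12 crew, wave 2, seat abc-iut-c312-7; claim W2-B); TAKES NO
SIDE. The first clause of the conclusion of [IUTchIII] Cor. 3.12 (kurims `paper:url-4b091feeb646` p. 174 l. 16),
"`−|log(Θ)| ∈ ℝ`", is obtained in the proof's opening paragraph (p. 175 l. 2–4) "from the [easily verified]
compactness of the `^{1,∘}𝒰_{j,v_ℚ}`", i.e. of the unions of the possible images of the Θ-pilot object; Dupuy–Hilado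
§4 (arXiv:2004.13228) make the mechanism explicit: "elements of Ind1 are just automorphisms … induced by
automorphisms of the `ℤ_p`-lattice `I^{⊗ j+1}_{V̲,p} ⊂ 𝕃_p^{(j)}`", "the Ind2 indeterminacies also preserve this
lattice" (§4 intro), "This map … fixes the lattice" (§4.7), so every possible image stays inside a fixed lattice
multiple. This file proves the corresponding BOOKKEEPING over c312-7's `Cor312.Setting` (no real instance needed):

* `image_eq_of_mem_indGroup`: if every (Ind1)- and (Ind2)-family maps a subset `W` of a packet ONTO itself, so
  does every element of the group they generate (`Setting.indGroup`, = c312-1 `LogShells.IndGroup`);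
* `sUnion_possibleImages_subset`: hence the union of ALL possible images at `(j, v_ℚ)` lies in any such stable
  `W` containing the (Ind3)-enlarged Θ-region `thetaRegion3` — the typed form of "compactness of `𝒰_{j,v_ℚ}`"
  modulo boundedness of `W`;
* for settings assembled over real packets (`Setting.ofComparison`, Cor312SettingReal): `hullDefined_of_stable`
  — `HullDefined j v_ℚ` (the hull of the union exists and the local Θ-volume is a real number) follows from a
  stable `W` whose image in `⊕ K` is bounded together with non-degeneracy of the image of `thetaRegion3`; and
  `thetaLocal_ne_top_of_stable`.
What remains for "`−|log(Θ)| ∈ ℝ`" in a real instance is thus: lattice-stability of the generators (c312-5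
`Real.image_shell_of_mem_ismDH`, DH §4.9; permutations, DH §4.7), a bounded stable `W ⊇ thetaRegion3` (c312-3's
(Ind3)-bound `Ind3Datum`, DH (4.10)), and finite support over `v_ℚ` (Prop. 3.9 (iii)) — each owned elsewhere.
[claim: Mochizuki2012, status: disputed] for the quoted sentences; [cite: DupuyHilado2025, §4 intro, §4.7, §4.9].
Deliberately NOT here: any assertion that these hypotheses hold in IUT's situation; log-volumes; any judgement.
-/

noncomputable section

namespace Summit.ABC.IUTFork.Cor312

open Thm311 Literature.IUT.LogThetaLattice

namespace Setting

variable {T : ThetaIndex} {S : Situation T} (P : Setting S)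

/-- STABILITY PROPAGATES TO THE GENERATED GROUP: if every (Ind1)-family and every (Ind2)-family maps
`W ⊆ 𝓘^ℚ(^{S^±_{j+1}};𝒟^⊢_{v_ℚ})` onto itself, then so does every element of the subgroup they generate (Dupuy–Hilado
§4: Ind1 "fixes the lattice", Ind2 "preserve this lattice"). PROVED by closure induction. [folklore] -/
theorem image_eq_of_mem_indGroup {j : T.Label} {vQ : T.VQ} (W : Set (S.L.Packet j vQ))
    (hW : ∀ Φ ∈ S.L.Ind1Family ∪ S.L.Ind2Family, Φ j vQ '' W = W)
    {Φ : ∀ (j : T.Label) (vQ : T.VQ), S.L.Packet j vQ ≃ₗ[ℚ] S.L.Packet j vQ} (hΦ : Φ ∈ indGroup S) :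
    Φ j vQ '' W = W := by
  induction hΦ using Subgroup.closure_induction with
  | mem Ψ hΨ => exact hW Ψ hΨ
  | one => simp
  | mul Ψ₁ Ψ₂ _ _ ih₁ ih₂ =>
    have hcomp : ⇑((Ψ₁ * Ψ₂) j vQ) = ⇑(Ψ₁ j vQ) ∘ ⇑(Ψ₂ j vQ) := by
      funext x
      rfl
    rw [hcomp, Set.image_comp, ih₂, ih₁]
  | inv Ψ _ ih =>
    change ⇑((Ψ j vQ).symm) '' W = W
    conv_lhs => rw [← ih]
    rw [Set.image_image]
    simp only [LinearEquiv.symm_apply_apply, Set.image_id']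

/-- **The union of the possible images lies in any (Ind1)/(Ind2)-stable set containing the (Ind3)-region**
([IUTchIII] proof of Cor. 3.12, p. 175 l. 2: "compactness of the `^{1,∘}𝒰_{j,v_ℚ}`"; Dupuy–Hilado §4:
`U_Θ = Ind2(Ind1((O_𝕃(−P_Θ))^{Ind3}))` inside the lattice multiple). PROVED. [folklore] -/
theorem sUnion_possibleImages_subset {j : T.Label} {vQ : T.VQ} {W : Set (S.L.Packet j vQ)}
    (hW : ∀ Φ ∈ S.L.Ind1Family ∪ S.L.Ind2Family, Φ j vQ '' W = W) (h3 : P.thetaRegion3 j vQ ⊆ W) :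
    ⋃₀ P.possibleImages j vQ ⊆ W := by
  apply Set.sUnion_subset
  rintro U ⟨Φ, hΦ, rfl⟩
  rw [← image_eq_of_mem_indGroup W hW hΦ]
  exact Set.image_mono h3

/-- Every possible image is itself inside such a stable `W`. [folklore] -/
theorem possibleImage_subset {j : T.Label} {vQ : T.VQ} {W : Set (S.L.Packet j vQ)}
    (hW : ∀ Φ ∈ S.L.Ind1Family ∪ S.L.Ind2Family, Φ j vQ '' W = W) (h3 : P.thetaRegion3 j vQ ⊆ W)
    {U : Set (S.L.Packet j vQ)} (hU : U ∈ P.possibleImages j vQ) : U ⊆ W :=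
  (Set.subset_sUnion_of_mem hU).trans (P.sUnion_possibleImages_subset hW h3)

/-- The union of the possible images always contains the (Ind3)-region (identity indeterminacy), so a
property monotone under enlargement (non-degeneracy) passes from `thetaRegion3` to the union. [folklore] -/
theorem thetaRegion3_subset_sUnion (j : T.Label) (vQ : T.VQ) :
    P.thetaRegion3 j vQ ⊆ ⋃₀ P.possibleImages j vQ :=
  Set.subset_sUnion_of_mem (P.thetaRegion3_mem_possibleImages j vQ)

end Setting

/-! ## For settings assembled over real packets (`Setting.ofComparison`) -/

namespace Setting

open Literature.IUT.LogVolume in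
/-- Non-degeneracy is monotone: a superset of a nondegenerate subset of `⊕_i K_i` is nondegenerate. [folklore] -/
theorem isNondegenerate_mono {J : Type} {K : J → Type} [∀ i, NontriviallyNormedField (K i)]
    {U U' : Set (∀ i, K i)} (h : U ⊆ U') (hU : IsNondegenerate K U) : IsNondegenerate K U' :=
  fun i => by obtain ⟨u, hu, hne⟩ := hU i; exact ⟨u, h hu, hne⟩

variable {T : ThetaIndex} {S : Situation T}
variable (n : ℤ) {HT : Type} {LogLink : HT → HT → Type} {IsFull : ∀ {s t : HT}, LogLink s t → Prop}
  (lat : LGPGaussianLogThetaLattice LogLink IsFull)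
  {Frd : Type} {IsoF : Frd → Frd → Type} {Ob : Frd → Type} {realify : Frd → Frd} {Strip : Type}
  {IsoS : Strip → Strip → Type} {M : ∀ v : T.V, v ∈ T.Vbad → Type} [∀ v h, Monoid (M v h)]
  (sig : GlobalLGPFrobenioidSignature T.lstar T.V (· ∈ T.Vbad) Frd IsoF Ob realify Strip IsoS M)
  (split : SplittingMonoids M) {ObΔ : Type} {N : ∀ v : T.V, v ∈ T.Vbad → Type} [∀ v h, Monoid (N v h)]
  (qData : QPilotData ObΔ N) (R : RealPieces S (Ob sig.Clgp) ObΔ)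
  (hq : ∀ j vQ i, R.qCentre (qPilotObject qData) j vQ i ≠ 0)
  (hadm : ∀ j vQ (H : Set (∀ i, R.K j vQ i)), Literature.IUT.LogVolume.IsHullSet (R.K j vQ) H →
    (S.D n).Adm j vQ (R.e j vQ ⁻¹' H))
  (hfin : ∀ j : T.Label, (Function.support fun vQ => (S.D n).logvol j vQ
    (R.e j vQ ⁻¹' Literature.IUT.LogVolume.hullSet (R.K j vQ) (R.qCentre (qPilotObject qData) j vQ))).Finite)

/-- **`HullDefined` from lattice stability**, for a setting assembled over real packets: if some `W` with
BOUNDED image in `⊕_i K_i` is mapped onto itself by every (Ind1)/(Ind2)-family and contains the (Ind3)-region,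
whose image is NONDEGENERATE, then the union of the possible images at `(j, v_ℚ)` admits its holomorphic hull
(so the local Θ-volume there is a real number). PROVED — the typed content of "one concludes easily from the
[easily verified] compactness of the `^{1,∘}𝒰_{j,v_ℚ}` … that the quantity `−|log(Θ)|` is finite" (p. 175 l. 2–4),
modulo the three owned inputs named in the module docstring. [claim: Mochizuki2012, status: disputed] -/
theorem hullDefined_of_stable (j : T.Label) (vQ : T.VQ) (W : Set (S.L.Packet j vQ))
    (hW : ∀ Φ ∈ S.L.Ind1Family ∪ S.L.Ind2Family, Φ j vQ '' W = W)
    (h3 : (ofComparison n lat sig split qData R hq hadm hfin).thetaRegion3 j vQ ⊆ W)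
    (hb : Bornology.IsBounded (R.e j vQ '' W))
    (hnd : Literature.IUT.LogVolume.IsNondegenerate (R.K j vQ)
      (R.e j vQ '' (ofComparison n lat sig split qData R hq hadm hfin).thetaRegion3 j vQ)) :
    (ofComparison n lat sig split qData R hq hadm hfin).HullDefined j vQ := by
  rw [ofComparison_hullDefined_iff]
  set P := ofComparison n lat sig split qData R hq hadm hfin
  refine ⟨hb.subset (Set.image_mono (P.sUnion_possibleImages_subset hW h3)),
    isNondegenerate_mono (Set.image_mono (P.thetaRegion3_subset_sUnion j vQ)) hnd⟩

/-- Consequently the local Θ-volume at `(j, v_ℚ)` is a real number (not `+∞`). [folklore] -/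
theorem thetaLocal_ne_top_of_stable (j : T.Label) (vQ : T.VQ) (W : Set (S.L.Packet j vQ))
    (hW : ∀ Φ ∈ S.L.Ind1Family ∪ S.L.Ind2Family, Φ j vQ '' W = W)
    (h3 : (ofComparison n lat sig split qData R hq hadm hfin).thetaRegion3 j vQ ⊆ W)
    (hb : Bornology.IsBounded (R.e j vQ '' W))
    (hnd : Literature.IUT.LogVolume.IsNondegenerate (R.K j vQ)
      (R.e j vQ '' (ofComparison n lat sig split qData R hq hadm hfin).thetaRegion3 j vQ)) :
    (ofComparison n lat sig split qData R hq hadm hfin).thetaLocal j vQ ≠ ⊤ := by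
  have h := hullDefined_of_stable n lat sig split qData R hq hadm hfin j vQ W hW h3 hb hnd
  unfold Setting.thetaLocal
  rw [if_pos h]
  exact WithTop.coe_ne_top

end Setting


/-! ## Lattice multiples: stability of `W` gives stability of every rational multiple `c • W`

(Dupuy–Hilado §4 intro: the indeterminacies are "automorphisms of the `ℤ_p`-lattice `I^{⊗ j+1}`", hence of every
`p^{-k} I^{⊗ j+1}`; abc-iut-c312-5's `Thm311RealLattice` proves `Φ '' shellPk = shellPk` for the (Ind1)/(Ind2)
families of every `LogShells` — with the lemmas below that single fact bounds ALL possible images inside any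
lattice multiple `c • shellPk` containing the (Ind3)-region.) -/

namespace Setting

variable {T : ThetaIndex} {S : Situation T} (P : Setting S)

open scoped Pointwise in
/-- A linear automorphism mapping `W` onto itself maps every rational multiple `c • W` onto itself. [folklore] -/
theorem image_smul_set_eq_of_image_eq {j : T.Label} {vQ : T.VQ} (Φ : S.L.Packet j vQ ≃ₗ[ℚ] S.L.Packet j vQ)
    {W : Set (S.L.Packet j vQ)} (hW : Φ '' W = W) (c : ℚ) : Φ '' (c • W) = c • W := by
  ext y
  constructor
  · rintro ⟨x, hx, rfl⟩
    obtain ⟨w, hw, rfl⟩ := Set.mem_smul_set.mp hx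
    refine Set.mem_smul_set.mpr ⟨Φ w, ?_, by rw [map_smul]⟩
    rw [← hW]
    exact ⟨w, hw, rfl⟩
  · intro hy
    obtain ⟨w', hw', rfl⟩ := Set.mem_smul_set.mp hy
    rw [← hW] at hw'
    obtain ⟨w, hw, rfl⟩ := hw'
    exact ⟨c • w, Set.smul_mem_smul_set hw, by rw [map_smul]⟩

open scoped Pointwise in
/-- **All possible images inside a lattice multiple**: if every (Ind1)/(Ind2)-family maps `W` onto itself
(e.g. `W = shellPk`, abc-iut-c312-5 `Thm311RealLattice`) and the (Ind3)-region lies in `c • W` (Dupuy–Hilado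
(4.10)), then the union of the possible images lies in `c • W`. PROVED. [folklore] -/
theorem sUnion_possibleImages_subset_smul {j : T.Label} {vQ : T.VQ} {W : Set (S.L.Packet j vQ)}
    (hW : ∀ Φ ∈ S.L.Ind1Family ∪ S.L.Ind2Family, Φ j vQ '' W = W) (c : ℚ)
    (h3 : P.thetaRegion3 j vQ ⊆ c • W) : ⋃₀ P.possibleImages j vQ ⊆ c • W :=
  P.sUnion_possibleImages_subset (fun Φ hΦ => image_smul_set_eq_of_image_eq (Φ j vQ) (hW Φ hΦ) c) h3

end Setting

end Summit.ABC.IUTFork.Cor312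

end
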